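import Summits.AtomisticToContinuum.HydrodynamicLimit.Theses.ImplosionDichotomy
import Literature.Analysis.FluidPDE.HardSphereCollisionRecord

/-!
# The two crux-input "Shapes" of line `Sketch` (ideator 2, card `kato-margin-odd-contact-defect`) are VACUOUS as typed

Lead `prover-line-stmt-AtomisticToContinuum-17372-c1-0`, line cycle 2 — L0 eligibility audit of payload line `Sketch` =
`Cruxes/HydroLimitProfilewiseBand/IdeatorTwoSketch.lean` (that workfile is not a built module on the farm, so its definitions are
copied here VERBATIM — §§3–5 of the sketch — under the namespace `Ideator2Audit`; nothing is re-typed).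

FINDING. In `ContactDefectMarginShape` and `DefectProductionMarginShape` the reduced density `σ` is a SECTION VARIABLE (a parameter of
the def, bound before the body), while the body reads `∃ σ₀, 0 < σ₀ ∧ (0 < σ → σ < σ₀ → …)`: the threshold is chosen AFTER `σ`, so the
witness `σ₀ := σ` when `0 < σ` (guard `σ < σ` false) and `σ₀ := 1` when `σ ≤ 0` (guard `0 < σ` false) proves both Shapes for EVERY
choice of their functional parameters (`chaos`, `gap`, `wt`, `prod`, `src`) — and a consumer at the given `σ` receives nothing. The
intended typing binds `σ` INSIDE: `∃ σ₀, 0 < σ₀ ∧ ∀ σ, 0 < σ → σ < σ₀ → …` (with `Flows σ`, `meanCollisionStat σ …`, `meanDev σ …`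
depending on the inner `σ`). Recorded for the crux-plan seat that may cut this card into a line (for stmt-9133, which it serves
verbatim); it says nothing about the card's mathematics.
-/

noncomputable section

open MeasureTheory Set Filter Topology
open scoped ENNReal

namespace Summit.AtomisticToContinuum.HydrodynamicLimit.Cruxes.HydroLimitProfilewiseBand.Ideator2Audit

open Literature.MathematicalPhysics.KineticTheory Literature.Analysis.FluidPDE

variable (σ : ℝ) (a₀ θ₀ : T3 → ℝ) (u₀ : T3 → V3)

/-- VERBATIM `Ideator2.Flows`. [folklore] -/
abbrev Flows : Type :=
  (N : ℕ) → HardSphereFlow (Torus.geometry (Fin 3)) (hsDiameter σ N) (N + 1)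

/-- VERBATIM `Ideator2.meanOneBodyMarginal`. [folklore] -/
def meanOneBodyMarginal (Φ : Flows σ) (N : ℕ) (s : ℝ) : Measure (T3 × V3) :=
  ((Φ N).lawAt (localGibbsLaw σ a₀ u₀ θ₀ N (Φ N)) s).map (fun z => z 0)

/-- VERBATIM `Ideator2.Mark`. [folklore] -/
abbrev Mark : Type := ℝ × T3 × V3 × V3 × V3

/-- VERBATIM `Ideator2.markJ`. [folklore] -/
def markJ (m : Mark) : Mark :=
  (m.1, m.2.1, -m.2.2.1, (reflectVel m.2.2.1 (m.2.2.2.1, m.2.2.2.2)).1,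
    (reflectVel m.2.2.1 (m.2.2.2.1, m.2.2.2.2)).2)

/-- VERBATIM `Ideator2.meanCollisionStat`. [folklore] -/
def meanCollisionStat (Φ : Flows σ) (N : ℕ) (W : Set ℝ) (Ψ : Mark → ℝ) : ℝ :=
  ((N : ℝ) + 1) ^ (-(4 / 3 : ℝ)) *
    ∫ z, collisionSum (Torus.geometry (Fin 3)) (hsDiameter σ N) (fun t => (Φ N).flow t z) W
      (fun c => Ψ c.mark) ∂(localGibbsLaw σ a₀ u₀ θ₀ N (Φ N))

/-- VERBATIM `Ideator2.eulerOneBody`. [folklore] -/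
def eulerOneBody (ρ θ : ℝ → T3 → ℝ) (u : ℝ → T3 → V3) (s : ℝ) : Measure (T3 × V3) :=
  ((volume : Measure T3).prod (volume : Measure V3)).withDensity
    fun y => ENNReal.ofReal (localMaxwellian (ρ s y.1) (θ s y.1) (u s y.1) y.2)

/-- VERBATIM `Ideator2.meanDev`. [folklore] -/
def meanDev (Φ : Flows σ) (ρ θ : ℝ → T3 → ℝ) (u : ℝ → T3 → V3) (N : ℕ) (s : ℝ) : ℝ :=
  (InformationTheory.klDiv (meanOneBodyMarginal σ a₀ θ₀ u₀ Φ N s) (eulerOneBody ρ θ u s)).toReal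

/-- VERBATIM `Ideator2.ContactDefectMarginShape` (the sup-form crux input of consumer A). [folklore] -/
def ContactDefectMarginShape (chaos : Flows σ → ℕ → Set ℝ → (Mark → ℝ) → ℝ) (gap : ℝ)
    (wt : Mark → ℝ) : Prop :=
  ∃ κ : ℝ, 0 ≤ κ ∧ κ < 1 ∧ ∃ η : ℝ, 0 < η ∧ ∃ σ₀ : ℝ, 0 < σ₀ ∧ (0 < σ → σ < σ₀ →
    ∀ (T : ℝ) (ρ θ : ℝ → T3 → ℝ) (u : ℝ → T3 → V3), IsHardSphereEulerSolution σ T ρ u θ →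
      (∀ t ∈ Ico 0 T, ∀ x, ρ t x * σ ^ 3 < η) →
      ∀ Φ : Flows σ, TendstoHydroFieldsAt (fun N => localGibbsLaw σ a₀ u₀ θ₀ N (Φ N)) Φ ρ u θ 0 →
        ∀ t ∈ Ico 0 T, ∃ err : ℕ → ℝ, Tendsto err atTop (𝓝 0) ∧
          ∀ (N : ℕ) (Ψ : Mark → ℝ), (∀ m, Ψ (markJ m) = -Ψ m) → (∀ m, |Ψ m| ≤ wt m) →
            ∀ s h : ℝ, 0 ≤ s → 0 < h → s + h ≤ t →
              |meanCollisionStat σ a₀ θ₀ u₀ Φ N (Icc s (s + h)) Ψ - chaos Φ N (Icc s (s + h)) Ψ|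
                ≤ κ * gap * h * sSup ((meanDev σ a₀ θ₀ u₀ Φ ρ θ u N) '' Icc 0 (s + h)) + h * err N)

/-- VERBATIM `Ideator2.DefectProductionMarginShape` (the production-units crux input of consumer B). [folklore] -/
def DefectProductionMarginShape (prod src : Flows σ → ℕ → ℝ → ℝ → ℝ) : Prop :=
  ∃ δ : ℝ, 0 < δ ∧ ∃ η : ℝ, 0 < η ∧ ∃ σ₀ : ℝ, 0 < σ₀ ∧ (0 < σ → σ < σ₀ →
    ∀ (T : ℝ) (ρ θ : ℝ → T3 → ℝ) (u : ℝ → T3 → V3), IsHardSphereEulerSolution σ T ρ u θ →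
      (∀ t ∈ Ico 0 T, ∀ x, ρ t x * σ ^ 3 < η) →
      ∀ Φ : Flows σ, TendstoHydroFieldsAt (fun N => localGibbsLaw σ a₀ u₀ θ₀ N (Φ N)) Φ ρ u θ 0 →
        ∀ t ∈ Ico 0 T, ∃ C : ℝ, ∃ err : ℕ → ℝ, Tendsto err atTop (𝓝 0) ∧ ∀ N : ℕ,
          src Φ N 0 (σ ^ 2 * ((N : ℝ) + 1) ^ (1 / 3 : ℝ) * t)
            ≤ (1 - δ) * prod Φ N 0 (σ ^ 2 * ((N : ℝ) + 1) ^ (1 / 3 : ℝ) * t) + C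
              + err N * (σ ^ 2 * ((N : ℝ) + 1) ^ (1 / 3 : ℝ) * t))

/-- **`ContactDefectMarginShape` is vacuously true for all parameters**: `κ := 0`, `η := 1`, and `σ₀ := σ` if `0 < σ` (then the
guard `σ < σ₀` is false) else `σ₀ := 1` (then the guard `0 < σ` is false). [folklore] -/
theorem contactDefectMarginShape_trivial (chaos : Flows σ → ℕ → Set ℝ → (Mark → ℝ) → ℝ) (gap : ℝ) (wt : Mark → ℝ) :
    ContactDefectMarginShape σ a₀ θ₀ u₀ chaos gap wt := by
  by_cases hσ : 0 < σ
  · exact ⟨0, le_rfl, one_pos, 1, one_pos, σ, hσ, fun _ hlt => absurd hlt (lt_irrefl σ)⟩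
  · exact ⟨0, le_rfl, one_pos, 1, one_pos, 1, one_pos, fun h _ => absurd h hσ⟩

/-- **`DefectProductionMarginShape` is vacuously true for all parameters** (same witness, `δ := 1`). [folklore] -/
theorem defectProductionMarginShape_trivial (prod src : Flows σ → ℕ → ℝ → ℝ → ℝ) :
    DefectProductionMarginShape σ a₀ θ₀ u₀ prod src := by
  by_cases hσ : 0 < σ
  · exact ⟨1, one_pos, 1, one_pos, σ, hσ, fun _ hlt => absurd hlt (lt_irrefl σ)⟩
  · exact ⟨1, one_pos, 1, one_pos, 1, one_pos, fun h _ => absurd h hσ⟩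

end Summit.AtomisticToContinuum.HydrodynamicLimit.Cruxes.HydroLimitProfilewiseBand.Ideator2Audit

end
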